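/- Copyright: the b2b-balaban cell (near-miss cell 7), T⁴-continuum fan-out; row NE7b ROUND-2 swarm, seat
t4-ne7b-formalise-leaf-09 (gen 6) (row S12 «ASSEMBLY», offer «S12i-pos» over the owner's sub-rows S12g ∕ S12i ∕ S12k;
journal INTENT l.16413).  Released under the licence of the surrounding project. -/
import Summits.QuantumFields.BalabanUV.T4Continuum.Support.HistoryRealiseCellsRunHeadline
import Summits.QuantumFields.BalabanUV.T4Continuum.Support.HistoryRealiseCellsRunHeadlineT3b
import Summits.QuantumFields.BalabanUV.T4Continuum.Support.HistoryRealiseCellsRunHeadlineT3bP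
import Summits.QuantumFields.BalabanUV.T4Continuum.Support.HistoryConstantsSlackT3bP

/-!
# Realised histories: THE HEADLINES OF RECORD WITH THE CONSTANTS SIDE DISCHARGED FOR EVERY POSITIVE PRINT RECORD

Summits-side support leaf of the T⁴-continuum cell (rung (B)+1 on a FINITE torus only; NOT infinite volume, NOT the
mass gap, NOT the Clay statement; NOT a proof of the spine estimate NE7b).  Row S12 ∕ node A12-I of the claim table
`t4/b2b-balaban-t4-ne7b-p1/LEAVES-NE7b.md`; offer «S12i-pos» (journal l.16413) over the owner's S12g headline of record
(v2 form, `HistoryRealiseCellsRunHeadline.continuumYM4Torus_of_countRoad_fsc`, p219850), leaf-02 g9's S12i headline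
(T3b form, `HistoryRealiseCellsRunHeadlineT3b.continuumYM4Torus_of_countRoadT3b_fsc`, p223402, R-OWNER-23-11 WITH THE
CONSTANTS CAVEAT) and leaf-08 g7's S12k census (`HistoryConstantsSlackT3b` p223209, `HistoryConstantsSlackT3bP` p223575 ∕
p223753).

WHY.  Both headlines of record carry their constants record `C : Consts` and its side conditions (`Dominates C O` resp.
the slack ∕ stride ∕ decay bundle, `ThresholdOK`, `0 < μ`, the `κ₁`∕`E₀` largeness, `13 ≤ n₁`, `β₀`, …) as DISPLAYED
binders — symbolic, as the trigger's c2∕c6 require.  The typer's acceptance test M6 («non-vacuity of the displayed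
constants-side antecedent at O(1) printed constants») and R-OWNER-23-12 (C) («the apex can quantify ∀ `O.Pos` on the
constants side») ask whether that displayed side is MET, and met in a way the headline CONSUMES.  Row S12k answered the
first half as stand-alone existentials.  THIS FILE is the second half, in the kernel, AT THE HEADLINE LEVEL: corollaries
of the two headlines whose only constants-type hypothesis is `O.Pos` (every printed O(1) positive), the H3 ∕ seam witness
family being displayed FOR EVERY ADMISSIBLE RECORD (`hData : ∀ C β₀ …, ‹the headline's constants-side binders› → …`; the
natural reading of H3 — any print-dominating record prices print's operations — and a STRONGER hypothesis than the
headlines', so these are corollaries, not replacements; the census wording stays the owner's).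

WHAT ([folklore] compositions BY NAME; no `def`, no `[cite:]` tag, nothing printed asserted, no `Prop` fact minted (c1);
the class-linear constant of row S6g′'s instance is pasted VERBATIM from p223402):
* §1 v2 FORM (Dominates road) — **`targets_of_countRoad_pos_fsc`**, **`continuumYM4Torus_of_countRoad_pos_fsc`**:
  `(hO : O.Pos)` + `hData` over every `(C, β₀)` meeting p219850's constants side ⊢ the four T⁴ targets ∕
  `ContinuumYM4Torus D`; the record is leaf-08 g7's `HistoryConstantsSlackT3b.exists_consts_END3` at slack `θ := 0`.
  NO demand on print's constants beyond positivity.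
* §2 T3b FORM OF RECORD (multiplicity proved, R-OWNER-23-11) — **`continuumYM4Torus_of_countRoadT3b_pos_fsc`**:
  `(hO : O.Pos)` + THE LOCATED DEMAND AS THE ONE PRINTED-CONSTANTS HYPOTHESIS, verbatim the right member of leaf-08 g7's
  `HistoryConstantsSlackT3b.END3_consts_iff` ∕ `…SlackT3bP.END3_full_consts_iff` —
  `hdemand : ∃ θc sS, ‹stride∕decay side conditions at F.L› ∧ ΘJ(d,sS,θc) + 8·2^d·log(2d+1) < ½·O.γ₀·O.A₁²` — + `hData`
  over every `(C, β₀, θ, sS, θc)` meeting p223402's constants side ⊢ `ContinuumYM4Torus D`.  This is R-OWNER-23-11's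
  CAVEAT rendered as a kernel hypothesis: by `HistoryConstantsSlackT3b.theta_floor` the demand forces
  `8·8710^d < ½γ₀A₁²` (`demand_floor_of_hdemand` below; ≈ 4.6·10¹⁶ at `d = 4`, leaf-08 g7), and WITHOUT it the T3b
  headline's constants side is EMPTY (`HistoryConstantsSlackT3b.not_exists_END3_consts_of_le`, leaf-02 g9's
  `demand_of_countRoadT3b_consts`) — nothing is hidden and nothing is added.
* §3 is reserved (v1.1, append-only, ON EVENT): the T3bP form over END OF RECORD v3.1′ (R-OWNER-23-12; leaf-02 g9's S12i
  v1.1) with NO demand, the record and the profile level from `HistoryConstantsSlackT3bP.END3P_consts_window` ∕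
  `HistoryFlowProfileLevel.thresholdPaid_of_window` BY NAME.

HONEST.  Corollaries with a STRONGER displayed hypothesis and NO free constants; they show that the headlines' constants
sides are met and consumed in the kernel for every positive print record (v2 form: unconditionally; T3b form: under —
and, by leaf-08 g7 ∕ leaf-02 g9, only under — the located demand).  They discharge NOTHING of H3 (realised pedigrees
with domains, realised costs, the printed price sentence, the numerator readings incl. `resumM`), the E1∕E2
representation, the (B)-side data, `BetaPertHyp`, NE7c's `ShellWeightBound`, NE7's `ReindexedBudget`, the four rates —
all inside `hData`, now asked for every admissible record.  NE7b NOT proved; spine PROVED 0∕9.  HONEST DEPENDENCY (cell):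
continuum YM on T⁴ ⇐ BetaPertH ∧ nine spine estimates (0/9 proved); BetaPertH ⇐ (D1) ∧ (D4) ∧ CAP+tail; G-an2-4 gates
asym, D1 and NE2/3/4.  This file changes none of it. -/

open Literature.MathematicalPhysics.QuantumFieldTheory.Balaban1983to89
open T4Continuum T4PrintedShapeBanking T4CanonicalMenus
open Summit.QuantumFields.BalabanUV.T4Continuum.CountThresholdUniform
open Summit.QuantumFields.BalabanUV.T4Continuum.HistoryConstants
open Summit.QuantumFields.BalabanUV.T4Continuum.HistoryFlow (two_le_L)
open Summit.QuantumFields.BalabanUV.T4Continuum.HistoryZoneEvolve (cth)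
open Summit.QuantumFields.BalabanUV.T4Continuum.HistoryConstantsSlackT3b
open Summit.QuantumFields.BalabanUV.T4Continuum.HistoryRealiseCellsRunApex
open Summit.QuantumFields.BalabanUV.T4Continuum.HistoryRealiseCellsRunApexT3b
open Summit.QuantumFields.BalabanUV.T4Continuum.HistoryRealiseCellsRunHeadline
open Summit.QuantumFields.BalabanUV.T4Continuum.HistoryRealiseCellsRunHeadlineT3b

namespace Summit.QuantumFields.BalabanUV.T4Continuum.HistoryRealiseCellsRunHeadlinePos

noncomputable section

/-! ## §0 Two arithmetic read-outs of `O.Pos` -/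

section Arith

variable {O : PrintedO1s}

/-- print's class-linear slack constant `½·γ₀·A₁²` is positive for a positive record. [folklore] -/
theorem half_gamma_A1_sq_pos (hO : O.Pos) : 0 < O.γ₀ * O.A₁ ^ 2 / 2 := by
  have := hO.γ₀_pos; have := hO.A₁_pos; positivity

/-- `1 ≤ F.L` for a torus family (from `HistoryFlow.two_le_L`). [folklore] -/
theorem one_le_L (F : T4Family) : 1 ≤ F.L := le_trans one_le_two (two_le_L F)

end Arith

/-! ## §1 The v2-form headline of record, constants side discharged for every positive print record -/

section SUv2

variable {F : T4Family} {N : ℕ} [NeZero N] {ℰ : LoopAverage (Matrix.specialUnitaryGroup (Fin N) ℂ)}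

/-- **THE FOUR T⁴ TARGETS FROM THE COUNT ROAD (v2 form), CONSTANTS SIDE DISCHARGED**: for (0.4)-block-averaged `SU(N)`
data with a measurable small-loop average, the sign conventions, ANY positive print record `O` (`O.Pos`), and the
count-road witness family displayed FOR EVERY ADMISSIBLE CONSTANTS RECORD — `hData` takes `(C, β₀)` with
`Dominates C O`, `ThresholdOK C F.L rr β₀`, `0 < C.μ`, the `κ₁`∕`E₀` largeness, `1 ≤ C.A₀`, `13 ≤ C.n₁`, `0 < C.E₂`,
`0 ≤ C.E₃`, `0 < β₀`, `F.L·β₀ ≤ 1` as antecedents — the four T⁴ targets hold (inside their own `(B)`∕`BetaPertHyp`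
prefixes).  Proof: `HistoryRealiseCellsRunHeadline.targets_of_countRoad_fsc` (p219850) at leaf-08 g7's record
`HistoryConstantsSlackT3b.exists_consts_END3` (slack `θ := 0`).  CONDITIONAL on the displayed witnesses; NE7b NOT
proved. [folklore] -/
theorem targets_of_countRoad_pos_fsc (D : FiniteEpsData F (Matrix.specialUnitaryGroup (Fin N) ℂ))
    (hBA : D.IsBlockAveraged ℰ) (hE : ℰ.MeasurableE) (hsign : B16.SignConventions D.C)
    {O : PrintedO1s} (hO : O.Pos) (rr d n : ℕ) (hn : 0 < n)
    (hData : ∀ (C : T4PrintedShapeBanking.Consts) (β₀ : ℝ), Dominates C O → ThresholdOK C F.L rr β₀ → 0 < C.μ →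
      (d : ℝ) * Real.log F.L + 2 * Real.log 2 ≤ C.κ₁ → Real.log (2 + birthMass C) ≤ C.E₀ → 1 ≤ C.A₀ → 13 ≤ C.n₁ →
      0 < C.E₂ → 0 ≤ C.E₃ → 0 < β₀ → (F.L : ℝ) * β₀ ≤ 1 →
      T4ContinuumYM4Torus.ForSmallCouplings D fun g₀ => ∀ os : List (ULoop F),
        ∃ (ι α π : Type) (_ : DecidableEq ι) (_ : DecidableEq α) (_ : DecidableEq π),
          Nonempty (CountRoadWitness D C O rr d n g₀ os ι α π)) :
    D.ym4_torus_continuum_limit_exists ∧ D.ym4_torus_continuum_limit_unique ∧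
      D.limit_reflectionPositive ∧ D.limit_torusCovariant := by
  obtain ⟨C, β₀, hT, hD, hμ, hκ₁, hE₀, hA₀, hn₁, hE₂, hE₃, -, hβ₀, hLβ⟩ :=
    exists_consts_END3 hO le_rfl (half_gamma_A1_sq_pos hO) d (one_le_L F) rr
  exact targets_of_countRoad_fsc D hBA hE hsign hD hT hμ d n hκ₁ hE₀ hβ₀ hLβ hn₁ hn
    (hData C β₀ hD hT hμ hκ₁ hE₀ hA₀ hn₁ hE₂ hE₃ hβ₀ hLβ)

/-- **THE HEADLINE PREDICATE FROM THE COUNT ROAD (v2 form), CONSTANTS SIDE DISCHARGED**: `ContinuumYM4Torus D` for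
(0.4)-block-averaged `SU(N)` data ⇐ (B) ∧ `BetaPertHyp` ∧ sign conventions ∧ `O.Pos` ∧ [for EVERY admissible constants
record, for all small-coupling tuned runs and all loop strings, a `CountRoadWitness`].  No constants binder is left in
the statement: the v2 headline's constants side is met for every positive print record and consumed by the headline
(`HistoryRealiseCellsRunHeadline.continuumYM4Torus_of_countRoad_fsc` at `exists_consts_END3`).  Honest reading in the
module docstring; nothing of the nine discharged; NE7b NOT proved; count 0∕9. [folklore] -/
theorem continuumYM4Torus_of_countRoad_pos_fsc (D : FiniteEpsData F (Matrix.specialUnitaryGroup (Fin N) ℂ))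
    (hBA : D.IsBlockAveraged ℰ) (hE : ℰ.MeasurableE)
    (hB : B16.EndStatementBPrinted D.C) (hβ : BetaPertHyp D.βfun) (hsign : B16.SignConventions D.C)
    {O : PrintedO1s} (hO : O.Pos) (rr d n : ℕ) (hn : 0 < n)
    (hData : ∀ (C : T4PrintedShapeBanking.Consts) (β₀ : ℝ), Dominates C O → ThresholdOK C F.L rr β₀ → 0 < C.μ →
      (d : ℝ) * Real.log F.L + 2 * Real.log 2 ≤ C.κ₁ → Real.log (2 + birthMass C) ≤ C.E₀ → 1 ≤ C.A₀ → 13 ≤ C.n₁ →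
      0 < C.E₂ → 0 ≤ C.E₃ → 0 < β₀ → (F.L : ℝ) * β₀ ≤ 1 →
      T4ContinuumYM4Torus.ForSmallCouplings D fun g₀ => ∀ os : List (ULoop F),
        ∃ (ι α π : Type) (_ : DecidableEq ι) (_ : DecidableEq α) (_ : DecidableEq π),
          Nonempty (CountRoadWitness D C O rr d n g₀ os ι α π)) :
    T4ContinuumYM4Torus.ContinuumYM4Torus D := by
  obtain ⟨C, β₀, hT, hD, hμ, hκ₁, hE₀, hA₀, hn₁, hE₂, hE₃, -, hβ₀, hLβ⟩ :=
    exists_consts_END3 hO le_rfl (half_gamma_A1_sq_pos hO) d (one_le_L F) rr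
  exact continuumYM4Torus_of_countRoad_fsc D hBA hE hB hβ hsign hD hT hμ d n hκ₁ hE₀ hβ₀ hLβ hn₁ hn
    (hData C β₀ hD hT hμ hκ₁ hE₀ hA₀ hn₁ hE₂ hE₃ hβ₀ hLβ)

end SUv2

/-! ## §2 The T3b-form headline of record under exactly the located demand -/

section Demand

variable {O : PrintedO1s}

/-- **THE LOCATED DEMAND SUPPLIES THE WHOLE T3b CONSTANTS SIDE, WITH `Dominates` AND `1 ≤ A₀` RIDING ALONG**: for
`O.Pos`, `1 ≤ L`, if some admissible stride∕decay `(sS, θc)` has `ΘJ(d,sS,θc) + 8·2^d·log(2d+1) < ½γ₀A₁²` then ONE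
record `(C, β₀, θ, sS, θc)` meets every constants-side binder of the T3b headline (p223402) — `ThresholdOK`, `0 < μ`,
the `κ₁`∕`E₀` largeness, `1 ≤ A₀`, `0 < β₀`, `L·β₀ ≤ 1`, `13 ≤ n₁`, `0 ≤ θ`, `hslack`, `0 < E₂`, `0 ≤ E₃`, `hsS`,
`hsmall`, `hθc0`, `hθc1`, `hθcs`, `hθJ` (verbatim) — and is print-dominating.  (The `←` half of leaf-08 g7's
`END3_consts_iff`, re-run through `exists_consts_END3` at `θ := ΘJ + 8·2^d·log(2d+1)` so that `Dominates C O` is kept.)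
[folklore] -/
theorem exists_T3b_consts_of_demand (hO : O.Pos) (d : ℕ) {L : ℕ} (hL : 1 ≤ L) (rr : ℕ)
    (hdemand : ∃ (θc : ℝ) (sS : ℕ), 1 ≤ sS ∧
      (((2 * cth 32 1 sS + 1) ^ d : ℕ) : ℝ) * (5 : ℝ) ^ d * ((max 1 (2 * 32 + 2) : ℕ) : ℝ) ≤
          (L : ℝ) ^ (sS / 2) / 2 ∧
      0 ≤ θc ∧ θc < 1 ∧ 1 / 2 ≤ θc ^ sS ∧
      (2 +
            ((2 * (((2 * cth 32 1 sS + 1) ^ d : ℕ) : ℝ) * ((((2 * 32 + 1) ^ d : ℕ) : ℝ) * (4 * 2 ^ d)) +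
                  4 * ((((2 * cth 32 1 sS + 1) ^ d : ℕ) : ℝ) * (5 : ℝ) ^ d)) / (1 - θc) +
              2 * (2 * ((((2 * cth 32 1 sS + 1) ^ d : ℕ) : ℝ) * (5 : ℝ) ^ d))) +
            (2 * ((0 + 2 * Real.log (2 * d + 1)) + (2 * (d : ℝ) + 2 * Real.log (2 * d + 1)) *
                  (((max 1 (2 * 32 + 2) : ℕ) : ℝ) * (2 * ((((2 * cth 32 1 sS + 1) ^ d : ℕ) : ℝ) * (5 : ℝ) ^ d)))) +
              (2 * (d : ℝ) + 2 * Real.log (2 * d + 1)) * 1 *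
                (((max 1 (2 * 32 + 2) : ℕ) : ℝ) *
                    ((2 * (((2 * cth 32 1 sS + 1) ^ d : ℕ) : ℝ) * ((((2 * 32 + 1) ^ d : ℕ) : ℝ) * (4 * 2 ^ d)) +
                        4 * ((((2 * cth 32 1 sS + 1) ^ d : ℕ) : ℝ) * (5 : ℝ) ^ d)) / (1 - θc)) +
                  4 * 2 ^ d)) +
            10) + 8 * 2 ^ d * Real.log (2 * d + 1) < O.γ₀ * O.A₁ ^ 2 / 2) :
    ∃ (C : T4PrintedShapeBanking.Consts) (β₀ θ : ℝ) (sS : ℕ) (θc : ℝ),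
      ThresholdOK C L rr β₀ ∧ Dominates C O ∧ 0 < C.μ ∧
      (d : ℝ) * Real.log L + 2 * Real.log 2 ≤ C.κ₁ ∧ Real.log (2 + birthMass C) ≤ C.E₀ ∧ 1 ≤ C.A₀ ∧
      0 < β₀ ∧ (L : ℝ) * β₀ ≤ 1 ∧ 13 ≤ C.n₁ ∧
      0 ≤ θ ∧ C.a + θ ≤ O.γ₀ * O.A₁ ^ 2 / 2 ∧ 0 < C.E₂ ∧ 0 ≤ C.E₃ ∧
      1 ≤ sS ∧
      (((2 * cth 32 1 sS + 1) ^ d : ℕ) : ℝ) * (5 : ℝ) ^ d * ((max 1 (2 * 32 + 2) : ℕ) : ℝ) ≤ (L : ℝ) ^ (sS / 2) / 2 ∧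
      0 ≤ θc ∧ θc < 1 ∧ 1 / 2 ≤ θc ^ sS ∧
      (2 +
            ((2 * (((2 * cth 32 1 sS + 1) ^ d : ℕ) : ℝ) * ((((2 * 32 + 1) ^ d : ℕ) : ℝ) * (4 * 2 ^ d)) +
                  4 * ((((2 * cth 32 1 sS + 1) ^ d : ℕ) : ℝ) * (5 : ℝ) ^ d)) / (1 - θc) +
              2 * (2 * ((((2 * cth 32 1 sS + 1) ^ d : ℕ) : ℝ) * (5 : ℝ) ^ d))) +
            (2 * ((0 + 2 * Real.log (2 * d + 1)) + (2 * (d : ℝ) + 2 * Real.log (2 * d + 1)) *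
                  (((max 1 (2 * 32 + 2) : ℕ) : ℝ) * (2 * ((((2 * cth 32 1 sS + 1) ^ d : ℕ) : ℝ) * (5 : ℝ) ^ d)))) +
              (2 * (d : ℝ) + 2 * Real.log (2 * d + 1)) * 1 *
                (((max 1 (2 * 32 + 2) : ℕ) : ℝ) *
                    ((2 * (((2 * cth 32 1 sS + 1) ^ d : ℕ) : ℝ) * ((((2 * 32 + 1) ^ d : ℕ) : ℝ) * (4 * 2 ^ d)) +
                        4 * ((((2 * cth 32 1 sS + 1) ^ d : ℕ) : ℝ) * (5 : ℝ) ^ d)) / (1 - θc)) +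
                  4 * 2 ^ d)) +
            10) + 8 * 2 ^ d * Real.log (2 * d + 1) ≤ θ := by
  obtain ⟨θc, sS, hsS, hsmall, hθc0, hθc1, hθcs, hlt⟩ := hdemand
  have hfloor := theta_floor (d := d) (sS := sS) hθc0 hθc1 hsS le_rfl
  have hθ0 := le_trans (by positivity : (0 : ℝ) ≤ 8 * 8710 ^ d) hfloor
  obtain ⟨C, β₀, h, hD, hμ, hκ₁, hE₀, hA₀, hn₁, hE₂, hE₃, hslack, hβ₀, hLβ⟩ := exists_consts_END3 hO hθ0 hlt d hL rr
  exact ⟨C, β₀, _, sS, θc, h, hD, hμ, hκ₁, hE₀, hA₀, hβ₀, hLβ, hn₁, hθ0, hslack, hE₂, hE₃, hsS, hsmall, hθc0, hθc1,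
    hθcs, le_rfl⟩

/-- **THE DEMAND'S FLOOR** (leaf-08 g7's `theta_floor`, read onto the hypothesis of §2): the located demand forces
`8·8710^d < ½·γ₀·A₁²` of print's constants — the caveat of R-OWNER-23-10∕-11 in numbers. [folklore] -/
theorem demand_floor_of_hdemand {d L : ℕ}
    (hdemand : ∃ (θc : ℝ) (sS : ℕ), 1 ≤ sS ∧
      (((2 * cth 32 1 sS + 1) ^ d : ℕ) : ℝ) * (5 : ℝ) ^ d * ((max 1 (2 * 32 + 2) : ℕ) : ℝ) ≤
          (L : ℝ) ^ (sS / 2) / 2 ∧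
      0 ≤ θc ∧ θc < 1 ∧ 1 / 2 ≤ θc ^ sS ∧
      (2 +
            ((2 * (((2 * cth 32 1 sS + 1) ^ d : ℕ) : ℝ) * ((((2 * 32 + 1) ^ d : ℕ) : ℝ) * (4 * 2 ^ d)) +
                  4 * ((((2 * cth 32 1 sS + 1) ^ d : ℕ) : ℝ) * (5 : ℝ) ^ d)) / (1 - θc) +
              2 * (2 * ((((2 * cth 32 1 sS + 1) ^ d : ℕ) : ℝ) * (5 : ℝ) ^ d))) +
            (2 * ((0 + 2 * Real.log (2 * d + 1)) + (2 * (d : ℝ) + 2 * Real.log (2 * d + 1)) *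
                  (((max 1 (2 * 32 + 2) : ℕ) : ℝ) * (2 * ((((2 * cth 32 1 sS + 1) ^ d : ℕ) : ℝ) * (5 : ℝ) ^ d)))) +
              (2 * (d : ℝ) + 2 * Real.log (2 * d + 1)) * 1 *
                (((max 1 (2 * 32 + 2) : ℕ) : ℝ) *
                    ((2 * (((2 * cth 32 1 sS + 1) ^ d : ℕ) : ℝ) * ((((2 * 32 + 1) ^ d : ℕ) : ℝ) * (4 * 2 ^ d)) +
                        4 * ((((2 * cth 32 1 sS + 1) ^ d : ℕ) : ℝ) * (5 : ℝ) ^ d)) / (1 - θc)) +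
                  4 * 2 ^ d)) +
            10) + 8 * 2 ^ d * Real.log (2 * d + 1) < O.γ₀ * O.A₁ ^ 2 / 2) :
    (8 : ℝ) * 8710 ^ d < O.γ₀ * O.A₁ ^ 2 / 2 := by
  obtain ⟨θc, sS, hsS, -, hθc0, hθc1, -, hlt⟩ := hdemand
  exact lt_of_le_of_lt (theta_floor (d := d) (sS := sS) hθc0 hθc1 hsS le_rfl) hlt

end Demand

section SUT3b

variable {F : T4Family} {N : ℕ} [NeZero N] {ℰ : LoopAverage (Matrix.specialUnitaryGroup (Fin N) ℂ)}

/-- **THE HEADLINE PREDICATE FROM THE COUNT ROAD (T3b form of record), UNDER EXACTLY THE LOCATED DEMAND**: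
`ContinuumYM4Torus D` for (0.4)-block-averaged `SU(N)` data ⇐ (B) ∧ `BetaPertHyp` ∧ sign conventions ∧ `O.Pos` ∧
THE LOCATED DEMAND `hdemand` (some admissible stride∕decay has `ΘJ + 8·2^d·log(2d+1) < ½γ₀A₁²`; the right member of
leaf-08 g7's `END3_consts_iff`, forcing `8·8710^d < ½γ₀A₁²` by `demand_floor_of_hdemand`) ∧ [for EVERY constants record
meeting the T3b headline's constants side (incl. `Dominates C O`), for all small-coupling tuned runs and all loop
strings, a `CountRoadWitnessT3b`].  Proof: `HistoryRealiseCellsRunHeadlineT3b.continuumYM4Torus_of_countRoadT3b_fsc`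
(p223402) at the record of `exists_T3b_consts_of_demand`.  This is R-OWNER-23-11's CAVEAT as a kernel hypothesis,
neither hidden nor enlarged: without `hdemand` the T3b headline's constants side is empty
(`HistoryConstantsSlackT3b.not_exists_END3_consts_of_le`, `HistoryRealiseCellsRunHeadlineT3b.demand_of_countRoadT3b_consts`);
the repair is END v3.1′ (R-OWNER-23-12), §3 on event.  Multiplicity proved inside the witness road; nothing of the nine
discharged; NE7b NOT proved; count 0∕9. [folklore] -/
theorem continuumYM4Torus_of_countRoadT3b_pos_fsc (D : FiniteEpsData F (Matrix.specialUnitaryGroup (Fin N) ℂ))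
    (hBA : D.IsBlockAveraged ℰ) (hE : ℰ.MeasurableE)
    (hB : B16.EndStatementBPrinted D.C) (hβ : BetaPertHyp D.βfun) (hsign : B16.SignConventions D.C)
    {O : PrintedO1s} (hO : O.Pos) (rr d n : ℕ) (hn : 0 < n)
    (hdemand : ∃ (θc : ℝ) (sS : ℕ), 1 ≤ sS ∧
      (((2 * cth 32 1 sS + 1) ^ d : ℕ) : ℝ) * (5 : ℝ) ^ d * ((max 1 (2 * 32 + 2) : ℕ) : ℝ) ≤
          (F.L : ℝ) ^ (sS / 2) / 2 ∧
      0 ≤ θc ∧ θc < 1 ∧ 1 / 2 ≤ θc ^ sS ∧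
      (2 +
            ((2 * (((2 * cth 32 1 sS + 1) ^ d : ℕ) : ℝ) * ((((2 * 32 + 1) ^ d : ℕ) : ℝ) * (4 * 2 ^ d)) +
                  4 * ((((2 * cth 32 1 sS + 1) ^ d : ℕ) : ℝ) * (5 : ℝ) ^ d)) / (1 - θc) +
              2 * (2 * ((((2 * cth 32 1 sS + 1) ^ d : ℕ) : ℝ) * (5 : ℝ) ^ d))) +
            (2 * ((0 + 2 * Real.log (2 * d + 1)) + (2 * (d : ℝ) + 2 * Real.log (2 * d + 1)) *
                  (((max 1 (2 * 32 + 2) : ℕ) : ℝ) * (2 * ((((2 * cth 32 1 sS + 1) ^ d : ℕ) : ℝ) * (5 : ℝ) ^ d)))) +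
              (2 * (d : ℝ) + 2 * Real.log (2 * d + 1)) * 1 *
                (((max 1 (2 * 32 + 2) : ℕ) : ℝ) *
                    ((2 * (((2 * cth 32 1 sS + 1) ^ d : ℕ) : ℝ) * ((((2 * 32 + 1) ^ d : ℕ) : ℝ) * (4 * 2 ^ d)) +
                        4 * ((((2 * cth 32 1 sS + 1) ^ d : ℕ) : ℝ) * (5 : ℝ) ^ d)) / (1 - θc)) +
                  4 * 2 ^ d)) +
            10) + 8 * 2 ^ d * Real.log (2 * d + 1) < O.γ₀ * O.A₁ ^ 2 / 2)
    (hData : ∀ (C : T4PrintedShapeBanking.Consts) (β₀ θ : ℝ) (sS : ℕ) (θc : ℝ),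
      Dominates C O → ThresholdOK C F.L rr β₀ → 0 < C.μ →
      (d : ℝ) * Real.log F.L + 2 * Real.log 2 ≤ C.κ₁ → Real.log (2 + birthMass C) ≤ C.E₀ → 1 ≤ C.A₀ →
      0 < β₀ → (F.L : ℝ) * β₀ ≤ 1 → 13 ≤ C.n₁ → 0 ≤ θ → C.a + θ ≤ O.γ₀ * O.A₁ ^ 2 / 2 → 0 < C.E₂ → 0 ≤ C.E₃ →
      1 ≤ sS →
      (((2 * cth 32 1 sS + 1) ^ d : ℕ) : ℝ) * (5 : ℝ) ^ d * ((max 1 (2 * 32 + 2) : ℕ) : ℝ) ≤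
      (F.L : ℝ) ^ (sS / 2) / 2 →
      0 ≤ θc → θc < 1 → 1 / 2 ≤ θc ^ sS →
      (2 +
            ((2 * (((2 * cth 32 1 sS + 1) ^ d : ℕ) : ℝ) * ((((2 * 32 + 1) ^ d : ℕ) : ℝ) * (4 * 2 ^ d)) +
                  4 * ((((2 * cth 32 1 sS + 1) ^ d : ℕ) : ℝ) * (5 : ℝ) ^ d)) / (1 - θc) +
              2 * (2 * ((((2 * cth 32 1 sS + 1) ^ d : ℕ) : ℝ) * (5 : ℝ) ^ d))) +
            (2 * ((0 + 2 * Real.log (2 * d + 1)) + (2 * (d : ℝ) + 2 * Real.log (2 * d + 1)) *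
                  (((max 1 (2 * 32 + 2) : ℕ) : ℝ) * (2 * ((((2 * cth 32 1 sS + 1) ^ d : ℕ) : ℝ) * (5 : ℝ) ^ d)))) +
              (2 * (d : ℝ) + 2 * Real.log (2 * d + 1)) * 1 *
                (((max 1 (2 * 32 + 2) : ℕ) : ℝ) *
                    ((2 * (((2 * cth 32 1 sS + 1) ^ d : ℕ) : ℝ) * ((((2 * 32 + 1) ^ d : ℕ) : ℝ) * (4 * 2 ^ d)) +
                        4 * ((((2 * cth 32 1 sS + 1) ^ d : ℕ) : ℝ) * (5 : ℝ) ^ d)) / (1 - θc)) +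
                  4 * 2 ^ d)) +
            10) + 8 * 2 ^ d * Real.log (2 * d + 1) ≤ θ →
      T4ContinuumYM4Torus.ForSmallCouplings D fun g₀ => ∀ os : List (ULoop F),
        ∃ (ι α π : Type) (_ : DecidableEq ι) (_ : DecidableEq α) (_ : DecidableEq π),
          Nonempty (CountRoadWitnessT3b D C O rr d n hn g₀ os ι α π)) :
    T4ContinuumYM4Torus.ContinuumYM4Torus D := by
  obtain ⟨C, β₀, θ, sS, θc, hT, hD, hμ, hκ₁, hE₀, hA₀, hβ₀, hLβ, hn₁, hθ, hslack, hE₂, hE₃, hsS, hsmall, hθc0, hθc1,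
    hθcs, hθJ⟩ := exists_T3b_consts_of_demand hO d (one_le_L F) rr hdemand
  exact continuumYM4Torus_of_countRoadT3b_fsc D hBA hE hB hβ hsign hT hμ d n hκ₁ hE₀ hA₀ hβ₀ hLβ hn₁ hn hθ hslack
    hE₂ hE₃ hsS hsmall hθc0 hθc1 hθcs hθJ
    (hData C β₀ θ sS θc hD hT hμ hκ₁ hE₀ hA₀ hβ₀ hLβ hn₁ hθ hslack hE₂ hE₃ hsS hsmall hθc0 hθc1 hθcs hθJ)

end SUT3b


/-! ## §3 (v1.1, append-only) THE HEADLINE OF RECORD (T3bP form over END v3.1′, R-OWNER-23-13), constants side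
discharged for every positive print record — NO demand -/

section SUT3bP

open Summit.QuantumFields.BalabanUV.T4Continuum.HistoryRealiseCellsRunHeadlineT3bP

variable {F : T4Family} {N : ℕ} [NeZero N] {ℰ : LoopAverage (Matrix.specialUnitaryGroup (Fin N) ℂ)}

/-- **THE FOUR T⁴ TARGETS FROM THE COUNT ROAD OVER END v3.1′ (T3bP form), CONSTANTS SIDE DISCHARGED**: for
(0.4)-block-averaged `SU(N)` data with a measurable small-loop average, the sign conventions, ANY positive print record
`O`, and the `CountRoadWitnessT3b` family displayed FOR EVERY ADMISSIBLE RECORD `(C, β₀, θ, sS, θc)` — `hData` takes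
`Dominates C O` and every constants-side binder of the headline of record
`HistoryRealiseCellsRunHeadlineT3bP.targets_of_countRoadT3bP_fsc` (p224237) as antecedents, `0 < θ` included and NO
`hθJ` — the four T⁴ targets hold.  The record is leaf-08 g7's `HistoryConstantsSlackT3bP.END3P_consts_of_pos`
(`θ := ¼γ₀A₁²`; its level conjuncts unused — the pinned END v3.1′ finds its own level at the coupling threshold).  NO
inequality on print's constants beyond `O.Pos`.  CONDITIONAL on the displayed witnesses; NE7b NOT proved. [folklore] -/
theorem targets_of_countRoadT3bP_pos_fsc (D : FiniteEpsData F (Matrix.specialUnitaryGroup (Fin N) ℂ))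
    (hBA : D.IsBlockAveraged ℰ) (hE : ℰ.MeasurableE) (hsign : B16.SignConventions D.C)
    {O : PrintedO1s} (hO : O.Pos) (rr d n : ℕ) (hn : 0 < n)
    (hData : ∀ (C : T4PrintedShapeBanking.Consts) (β₀ θ : ℝ) (sS : ℕ) (θc : ℝ),
      Dominates C O → ThresholdOK C F.L rr β₀ → 0 < C.μ →
      (d : ℝ) * Real.log F.L + 2 * Real.log 2 ≤ C.κ₁ → Real.log (2 + birthMass C) ≤ C.E₀ → 1 ≤ C.A₀ →
      0 < β₀ → (F.L : ℝ) * β₀ ≤ 1 → 13 ≤ C.n₁ → 0 < θ → C.a + θ ≤ O.γ₀ * O.A₁ ^ 2 / 2 → 0 < C.E₂ → 0 ≤ C.E₃ →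
      1 ≤ sS →
      (((2 * cth 32 1 sS + 1) ^ d : ℕ) : ℝ) * (5 : ℝ) ^ d * ((max 1 (2 * 32 + 2) : ℕ) : ℝ) ≤
      (F.L : ℝ) ^ (sS / 2) / 2 →
      0 ≤ θc → θc < 1 → 1 / 2 ≤ θc ^ sS →
      T4ContinuumYM4Torus.ForSmallCouplings D fun g₀ => ∀ os : List (ULoop F),
        ∃ (ι α π : Type) (_ : DecidableEq ι) (_ : DecidableEq α) (_ : DecidableEq π),
          Nonempty (CountRoadWitnessT3b D C O rr d n hn g₀ os ι α π)) :
    D.ym4_torus_continuum_limit_exists ∧ D.ym4_torus_continuum_limit_unique ∧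
      D.limit_reflectionPositive ∧ D.limit_torusCovariant := by
  obtain ⟨C, β₀, θ, x, sS, θc, hT, hD, hμ, hκ₁, hE₀, hA₀, hn₁, hE₂, hE₃, hβ₀, hLβ, hθ, hslack, hsS, hsmall, hθc0, hθc1,
    hθcs, -, -, -⟩ := HistoryConstantsSlackT3bP.END3P_consts_of_pos hO d (two_le_L F) rr
  exact targets_of_countRoadT3bP_fsc D hBA hE hsign hT hμ d n hκ₁ hE₀ hA₀ hβ₀ hLβ hn₁ hn hθ hslack hE₂ hE₃ hsS hsmall
    hθc0 hθc1 hθcs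
    (hData C β₀ θ sS θc hD hT hμ hκ₁ hE₀ hA₀ hβ₀ hLβ hn₁ hθ hslack hE₂ hE₃ hsS hsmall hθc0 hθc1 hθcs)

/-- **THE HEADLINE OF RECORD OF ROW NE7b (T3bP form, R-OWNER-23-13), CONSTANTS SIDE DISCHARGED — NO DEMAND**:
`ContinuumYM4Torus D` for (0.4)-block-averaged `SU(N)` data ⇐ (B) ∧ `BetaPertHyp` ∧ sign conventions ∧ `O.Pos` ∧ [for
EVERY constants record meeting the headline's constants side (incl. `Dominates C O`, any positive slack `θ`), for all
small-coupling tuned runs and all loop strings, a `CountRoadWitnessT3b`].  Proof: the headline of record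
`HistoryRealiseCellsRunHeadlineT3bP.continuumYM4Torus_of_countRoadT3bP_fsc` (p224237) at the record of
`HistoryConstantsSlackT3bP.END3P_consts_of_pos`.  Compare §2: over END v3′ the same corollary needs the located demand
`hdemand`; over END v3.1′ it needs NOTHING beyond positivity — R-OWNER-23-12∕-13's «caveat lifted», at the headline level,
with no constants binder left in the statement.  The multiplicity is a theorem inside the witness road and its price
sits in the coupling threshold of the `ForSmallCouplings` prefix; nothing of the nine discharged; NE7b NOT proved;
count 0∕9. [folklore] -/
theorem continuumYM4Torus_of_countRoadT3bP_pos_fsc (D : FiniteEpsData F (Matrix.specialUnitaryGroup (Fin N) ℂ))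
    (hBA : D.IsBlockAveraged ℰ) (hE : ℰ.MeasurableE)
    (hB : B16.EndStatementBPrinted D.C) (hβ : BetaPertHyp D.βfun) (hsign : B16.SignConventions D.C)
    {O : PrintedO1s} (hO : O.Pos) (rr d n : ℕ) (hn : 0 < n)
    (hData : ∀ (C : T4PrintedShapeBanking.Consts) (β₀ θ : ℝ) (sS : ℕ) (θc : ℝ),
      Dominates C O → ThresholdOK C F.L rr β₀ → 0 < C.μ →
      (d : ℝ) * Real.log F.L + 2 * Real.log 2 ≤ C.κ₁ → Real.log (2 + birthMass C) ≤ C.E₀ → 1 ≤ C.A₀ →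
      0 < β₀ → (F.L : ℝ) * β₀ ≤ 1 → 13 ≤ C.n₁ → 0 < θ → C.a + θ ≤ O.γ₀ * O.A₁ ^ 2 / 2 → 0 < C.E₂ → 0 ≤ C.E₃ →
      1 ≤ sS →
      (((2 * cth 32 1 sS + 1) ^ d : ℕ) : ℝ) * (5 : ℝ) ^ d * ((max 1 (2 * 32 + 2) : ℕ) : ℝ) ≤
      (F.L : ℝ) ^ (sS / 2) / 2 →
      0 ≤ θc → θc < 1 → 1 / 2 ≤ θc ^ sS →
      T4ContinuumYM4Torus.ForSmallCouplings D fun g₀ => ∀ os : List (ULoop F),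
        ∃ (ι α π : Type) (_ : DecidableEq ι) (_ : DecidableEq α) (_ : DecidableEq π),
          Nonempty (CountRoadWitnessT3b D C O rr d n hn g₀ os ι α π)) :
    T4ContinuumYM4Torus.ContinuumYM4Torus D := by
  obtain ⟨C, β₀, θ, x, sS, θc, hT, hD, hμ, hκ₁, hE₀, hA₀, hn₁, hE₂, hE₃, hβ₀, hLβ, hθ, hslack, hsS, hsmall, hθc0, hθc1,
    hθcs, -, -, -⟩ := HistoryConstantsSlackT3bP.END3P_consts_of_pos hO d (two_le_L F) rr
  exact continuumYM4Torus_of_countRoadT3bP_fsc D hBA hE hB hβ hsign hT hμ d n hκ₁ hE₀ hA₀ hβ₀ hLβ hn₁ hn hθ hslack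
    hE₂ hE₃ hsS hsmall hθc0 hθc1 hθcs
    (hData C β₀ θ sS θc hD hT hμ hκ₁ hE₀ hA₀ hβ₀ hLβ hn₁ hθ hslack hE₂ hE₃ hsS hsmall hθc0 hθc1 hθcs)

end SUT3bP

end

end Summit.QuantumFields.BalabanUV.T4Continuum.HistoryRealiseCellsRunHeadlinePos
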